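import Summits.Ventures.CertifiedArithmetic.LowPrec.DoubleRoundingDivisionStrip

/-!
# Double rounding of products: a quantum at most `P` binades finer always slips (THEOREM N-mul-U)

HONEST FRAMING (venture CertifiedArithmetic / cell `pub-lowprec`): certified error envelopes and
provably optimal rounding/accumulation schemes for low-precision formats under stated cost models;
every table by two implementations; no hardware or vendor claims.

Clause (U) of THEOREM D-dm (`drMul_of_underflow_of_embedsTest`, `DoubleRoundingProduct.lean`)
makes the double rounding `fl_φ (fl_ψ (a · b))` of `φ`-products through a register `ψ` innocuous
under `F_φ ⊆ F_ψ`, `P_ψ ≥ 2 P_φ` and the UNDERFLOW CLAUSE `L_ψ + 2 P_φ ≤ L_φ` (`L = qexp`, the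
exponent of the quantum; `P = m + 1`): the quantum of `ψ` is at least `2 P_φ` binades finer than
that of `φ`; clause (E) under `L_ψ ≤ 2 L_φ` (every product is a value of `ψ`).  This file is the
NECESSITY side, for EVERY pair of records and WHATEVER THE PRECISION of `ψ`: with a quantum of `ψ`
only `1 ≤ d = L_φ - L_ψ ≤ P_φ` binades finer, some product of a deep source (`L_φ ≤ -2 P_φ`) slips
(§1).  So of the `2 P_φ - 1` values of `d` short of clause (U) the upper `P_φ` always fail; the
lower `P_φ - 1` — the GAP `P_φ + 1 ≤ d ≤ 2 P_φ - 1` — depend on the precision and are the subject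
of the window law (`DoubleRoundingProductWindow.lean`).

* §1 THEOREM N-mul-U.  (U1×) `not_drMul_of_underflow`: `m = m_φ ≥ 1`, `1 ≤ d ≤ m + 1`, the data
  `a = (2^(m+1) - 1)·2^α`, `b = (2^m + 1)·2^β` quanta of `φ` in range with
  `α + β + m + 3 = bias φ`, and `2^(d-1) ≤ M_ψ` `⟹ ¬ DRMul φ ψ` — NO hypothesis on `P_ψ`, no
  inclusion of the value sets: `a · b = q/2 + (2^m - 1)·q/2^(2m+2)` (`q = quantum φ`) exceeds
  the midpoint `q/2 = 2^(d-1)·quantum ψ` — a value of `ψ` — by less than `quantum ψ / 2` (iff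
  `d ≤ m + 1`), so `fl_ψ (a·b) = q/2 ↦ 0` (integrality of the grid of `ψ`; tie to even) while
  `fl_φ (a·b) = q`.  At `α = 0` the data are the largest datum `(2 - 2^-m)·2^(m + L_φ)` of the
  first normal binade and `(1 + 2^-m)·2^-(m+2)`.  (The quotient analogue N-div-U,
  `DoubleRoundingDivisionUnderflow.lean`, reaches `d ≤ m`; for products `d = m + 1 = P_φ` fails
  too.)
* §2 the hypothesis as a boolean test on records (`drMulUnderflowTest`, `α = 0`,
  `β = bias - m - 3`) and the named `13 × 13` matrix: exactly `4` cells, all with `d = 1` — the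
  embedded e5m2 → binary8p3f (`7·2^-16 · 5/64 = 35·2^-22 ↦ 2^-17 ↦ 0`, directly `2^-16`) and the
  non-embedded e5m2 → binary8p3, e4m3 → binary8p4 / binary8p4f (`15·2^-9 · 9/256 = 135·2^-17 ↦
  2^-10 ↦ 0`, directly `2^-9`); the shallow sources e2m1, e3m2, e2m3, binary8p5 (`L > -2P`)
  cannot host the witness, and no named register is `≤ P` binades finer than binary16 / bfloat16.

Two implementations: A = `code/enum/mul_underflow_law.py` (exact rationals, two RNE
implementations: the (U1×) family on pseudo-records `2 ≤ P_φ ≤ 12`, `P_φ - 1 ≤ P_ψ ≤ 3 P_φ`,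
every `1 ≤ d ≤ P_φ`, slips with the three predicted values; the `13 × 13` named cells) →
`certs/enum/DOUBLE-ROUNDING-MUL-UNDERFLOW.json`; B = the kernel (this file).  PLACEMENT — KNOWN:
innocuous double rounding of products for `p₂ ≥ 2p₁` with unbounded exponents [Figueroa1995, §3]
and, with gradual underflow, under `e_min₂ ≤ 2 e_min₁` [Roux2014, Table II] (Coq/Flocq, any tie
rule) — this packet's clause (E); clause (U) is the packet's weaker sufficient condition for deep
sources (`DoubleRoundingProduct.lean`); harmful double rounding of underflowing products through a
register of EQUAL precision and wider exponent range is the classical extended-register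
(`strictfp`) phenomenon.  We found no statement in print on which finer quanta `e_min₂ > e_min₁ -
2p₁` remain innocuous for products once `p₂ ≥ 2p₁` (searched 2026-08-21: held corpus, keyword +
vector, "double rounding multiplication underflow subnormal emin" and a prose paraphrase of (U1×)
— textbook rounding pages only; galaxy, all corpora, "double rounding" — the Goldberg-1991 reprint
and an x87 `strictfp` implementation paper, neither on this threshold).  NEW here: for every pair
of records and every `p₂`, a register quantum `1` to `p₁` binades finer is harmful for products of
a deep source; the remaining `p₁ - 1` binades are decided per precision by the window law.
No hardware or vendor claims.
-/


namespace Summit.Ventures.CertifiedArithmetic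

open Literature.ComputerArithmetic.FloatingPoint
open Literature.ComputerArithmetic.FloatingPoint.Format
open Literature.ComputerArithmetic.FloatingPoint.MiniFloat

/-- `DRMul φ ψ`: for all finite `a b` of `φ`, `fl_φ (fl_ψ (a · b)) = fl_φ (a · b)` (one product in
`ψ`, converted to `φ`, is the correctly rounded product of `φ`; saturating RNE, subnormals kept).
The property proved or refuted cell by cell in `DoubleRoundingProduct*.lean`, named.
[this packet; cite: Figueroa1995, §3] -/
def DRMul (φ ψ : Format) : Prop :=
  ∀ a b : MiniFloat φ, (roundNE φ (roundNE ψ (a.toRat * b.toRat)).toRat).toRat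
    = (roundNE φ (a.toRat * b.toRat)).toRat

/-! ## §1 THEOREM N-mul-U: a quantum at most `P_φ` binades finer is never innocuous -/

/-- THEOREM N-mul-U, WITNESS (U1) — for EVERY pair of format records: `m = m_φ ≥ 1`,
`1 ≤ d = L_φ - L_ψ ≤ m + 1 = P_φ`, the data `a = (2^(m+1) - 1)·2^α` and `b = (2^m + 1)·2^β` quanta
of `φ` in range with `α + β + m + 3 = bias φ` (so that `2^(α+β)·quantum φ = 2^-(2m+2)`), and
`2^(d-1) ≤ M_ψ` `⟹ ¬ DRMul φ ψ`:
`a · b = (2^(2m+1) + 2^m - 1)·q/2^(2m+2) = q/2 + (2^m - 1)·q/2^(2m+2)` (`q = quantum φ`) exceeds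
the midpoint `q/2 = 2^(d-1)·quantum ψ` — a value of `ψ` — by less than `quantum ψ / 2`
(iff `(2^m - 1)·2^d < 2^(2m+1)`, i.e. `d ≤ m + 1`), so `fl_ψ (a·b) = q/2` (integrality of the grid
of `ψ`), `fl_φ (q/2) = 0` (tie to even) while `fl_φ (a·b) = q`.  NO hypothesis on `P_ψ`, no
inclusion of the value sets.  In words: the largest significand times the successor of one,
scaled down to the least subnormal.  [this packet; cite: Figueroa1995, §3; cite: Roux2014, §4] -/
theorem not_drMul_of_underflow {φ ψ : Format} (hq : ψ.qexp + 1 ≤ φ.qexp)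
    (hd : φ.qexp ≤ ψ.qexp + (φ.manBits + 1)) (h1 : 1 ≤ φ.manBits) {α β : ℕ}
    (hαβ : α + β + φ.manBits + 3 = φ.bias)
    (ha : (2 ^ (φ.manBits + 1) - 1) * 2 ^ α ≤ φ.maxScaled)
    (hb : (2 ^ φ.manBits + 1) * 2 ^ β ≤ φ.maxScaled)
    (hy : 2 ^ ((φ.qexp - ψ.qexp).toNat - 1) ≤ ψ.maxScaled) : ¬ DRMul φ ψ := by
  intro hD
  have hq0 := φ.quantum_pos
  have hq1 := ψ.quantum_pos
  have hm2 : 2 ≤ 2 ^ φ.manBits := le_trans (by norm_num) (Nat.pow_le_pow_right (by norm_num) h1)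
  have hpow : 2 ^ (φ.manBits + 1) = 2 * 2 ^ φ.manBits := pow_succ' 2 _
  set d := (φ.qexp - ψ.qexp).toNat with hd'
  have hd1 : 1 ≤ d := by omega
  have hdm : d ≤ φ.manBits + 1 := by omega
  have hQ : φ.quantum = 2 ^ d * ψ.quantum := quantum_eq_two_pow_mul (by omega)
  have hd2 : (2 : ℚ) ^ d = 2 * 2 ^ (d - 1) := by
    rw [← pow_succ']; congr 1; omega
  -- data
  obtain ⟨a, ha'⟩ := exists_toRat_eq_natMul
    (representable_mul_pow (φ := φ) (k := 2 ^ (φ.manBits + 1) - 1) (j := α) (by omega) ha)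
  obtain ⟨b, hb'⟩ := exists_toRat_eq_natMul
    (representable_mul_pow (φ := φ) (k := 2 ^ φ.manBits + 1) (j := β) (by omega) hb)
  -- casts of the data
  have hA : (((2 ^ (φ.manBits + 1) - 1) * 2 ^ α : ℕ) : ℚ) = (2 * 2 ^ φ.manBits - 1) * 2 ^ α := by
    rw [Nat.cast_mul, Nat.cast_sub Nat.one_le_two_pow]; push_cast; ring
  have hB : (((2 ^ φ.manBits + 1) * 2 ^ β : ℕ) : ℚ) = (2 ^ φ.manBits + 1) * 2 ^ β := by
    push_cast; ring
  -- the unit: `2^α · 2^β · 4 X² · q = 1` (`X = 2^m`)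
  have hone : (2 : ℚ) ^ (φ.manBits + (φ.bias - 1)) * φ.quantum = 1 :=
    two_pow_mul_quantum_eq_one (by omega)
  have e1 : φ.manBits + (φ.bias - 1) = α + β + (φ.manBits + φ.manBits + 2) := by omega
  rw [e1, pow_add, pow_add, pow_add, pow_add] at hone
  have hX2 : (2 : ℚ) ≤ 2 ^ φ.manBits := by exact_mod_cast hm2
  have key := hD a b
  rw [ha', hb', hA, hB] at key
  generalize hX : (2 : ℚ) ^ φ.manBits = X at hone hX2 key
  have hXpos : 0 < X := by linarith
  have hunit : (2 : ℚ) ^ α * 2 ^ β * φ.quantum = 1 / (4 * X ^ 2) := by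
    rw [eq_div_iff (by positivity), ← hone]; ring
  -- the product `a·b = q/2 + ε`, `ε = (X - 1)·q/(4X²)`
  set ε : ℚ := (X - 1) * φ.quantum / (4 * X ^ 2) with hε
  have hprod : (2 * X - 1) * 2 ^ α * φ.quantum * ((X + 1) * 2 ^ β * φ.quantum)
      = φ.quantum / 2 + ε := by
    calc (2 * X - 1) * 2 ^ α * φ.quantum * ((X + 1) * 2 ^ β * φ.quantum)
        = (2 * X - 1) * (X + 1) * ((2 : ℚ) ^ α * 2 ^ β * φ.quantum) * φ.quantum := by ring
      _ = (2 * X - 1) * (X + 1) * (1 / (4 * X ^ 2)) * φ.quantum := by rw [hunit]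
      _ = φ.quantum / 2 + ε := by rw [hε]; field_simp; ring
  have hεpos : 0 < ε := by
    rw [hε]; exact div_pos (mul_pos (by linarith) hq0) (by positivity)
  -- `ε < quantum ψ / 2`  (⟸ `(X - 1)·2^d < 2X²`, from `2^d ≤ 2X`)
  have hεlt : 2 * |ε| < ψ.quantum := by
    rw [abs_of_pos hεpos, hε]
    have h2d : (2 : ℚ) ^ d ≤ 2 * X := by
      rw [← hX, ← pow_succ']; exact pow_le_pow_right₀ (by norm_num) hdm
    have hψ : ψ.quantum = φ.quantum / 2 ^ d := by
      rw [hQ]; field_simp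
    rw [hψ, div_eq_mul_inv, div_eq_mul_inv]
    rw [show 2 * ((X - 1) * φ.quantum * (4 * X ^ 2)⁻¹) = φ.quantum * ((X - 1) / (2 * X ^ 2)) by
      field_simp; ring]
    rw [show φ.quantum * ((2 : ℚ) ^ d)⁻¹ = φ.quantum * (1 / 2 ^ d) by ring]
    apply mul_lt_mul_of_pos_left _ hq0
    rw [div_lt_div_iff₀ (by positivity) (by positivity), one_mul]
    nlinarith
  -- ε < q/2 (coarser)
  have hεq : ε < φ.quantum / 2 := by
    have : ψ.quantum ≤ φ.quantum / 2 := by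
      rw [hQ, hd2]
      have : (1 : ℚ) ≤ 2 ^ (d - 1) := one_le_pow₀ (by norm_num)
      nlinarith
    have h2 := abs_of_pos hεpos
    linarith
  -- the intermediate value `q/2 = 2^(d-1)·quantum ψ` on the grid of `ψ`
  have hμ : φ.quantum / 2 = ((2 ^ (d - 1) : ℕ) : ℚ) * ψ.quantum := by
    rw [hQ, hd2]; push_cast; ring
  have hY : (roundNE ψ (φ.quantum / 2 + ε)).toRat = φ.quantum / 2 := by
    rw [hμ]
    refine toRat_roundNE_natMul_add_small ?_ hεlt
    have h2 : 2 ^ (0 + 1) ≤ 2 ^ (ψ.manBits + 1) := Nat.pow_le_pow_right (by norm_num) (by omega)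
    simpa using representable_mul_pow (φ := ψ) (k := 1) (j := d - 1)
      (lt_of_lt_of_le (by norm_num) h2) (by simpa using hy)
  -- the two roundings in `φ`
  have hM1 : 1 ≤ φ.maxScaled := by
    have : 0 < (2 ^ φ.manBits + 1) * 2 ^ β := by positivity
    omega
  have hX1 : (roundNE φ (φ.quantum / 2)).toRat = 0 := by
    have h := toRat_roundNE_half_of_even h1 (j := 0) ⟨0, rfl⟩ (by omega) (by omega)
    have e : φ.quantum / 2 = ((2 * 0 + 1 : ℕ) : ℚ) / 2 * φ.quantum := by push_cast; ring
    rw [e, h]; push_cast; ring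
  have hX2r : (roundNE φ (φ.quantum / 2 + ε)).toRat = φ.quantum := by
    have hrep : φ.Representable 1 := representable_of_lt_pow (by omega) hM1
    have e : φ.quantum / 2 + ε = ((1 : ℕ) : ℚ) * φ.quantum + (ε - φ.quantum / 2) := by
      push_cast; ring
    rw [e, toRat_roundNE_natMul_add_small hrep
      (by rw [abs_of_neg (by linarith), neg_sub]; linarith)]
    push_cast; ring
  rw [hprod, hY, hX1, hX2r] at key
  linarith

/-! ## §2 The hypothesis as a boolean test; the named records -/

/-- THE HYPOTHESIS OF (U1×) AS A BOOLEAN TEST on parameter records, at the canonical exponents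
`α = 0` (the multiplicand `2^(m+1) - 1` quanta, the largest datum of the first normal binade) and
`β = bias_X - m_X - 3`. [this packet] -/
def drMulUnderflowTest (X Y : Format) : Bool :=
  let d := (X.qexp - Y.qexp).toNat
  let β := X.bias - X.manBits - 3
  decide (Y.qexp + 1 ≤ X.qexp) && decide (X.qexp ≤ Y.qexp + (X.manBits + 1)) &&
  decide (1 ≤ X.manBits) && decide (X.manBits + 3 ≤ X.bias) &&
  decide ((2 ^ (X.manBits + 1) - 1) * 2 ^ 0 ≤ X.maxScaled) &&
  decide ((2 ^ X.manBits + 1) * 2 ^ β ≤ X.maxScaled) && decide (2 ^ (d - 1) ≤ Y.maxScaled)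

/-- SOUNDNESS OF THE TEST: `drMulUnderflowTest X Y ⟹ ¬ DRMul X Y` ((U1×) at the canonical
exponents). [this packet] -/
theorem not_drMul_of_underflowTest {X Y : Format} (h : drMulUnderflowTest X Y = true) :
    ¬ DRMul X Y := by
  simp only [drMulUnderflowTest, Bool.and_eq_true, decide_eq_true_eq] at h
  obtain ⟨⟨⟨⟨⟨⟨hq, hd⟩, h1⟩, hβ⟩, ha⟩, hb⟩, hy⟩ := h
  exact not_drMul_of_underflow hq hd h1 (α := 0) (β := X.bias - X.manBits - 3) (by omega) ha hb hy

/-- ON THE NAMED `13 × 13` MATRIX the test holds on exactly `4` cells, all with `d = 1`: the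
embedded e5m2 → binary8p3f and the non-embedded e5m2 → binary8p3, e4m3 → binary8p4 / binary8p4f.
The shallow sources e2m1, e3m2, e2m3, binary8p5 (`L_X > -2 P_X`, i.e. `bias < m + 3`) cannot host
the witness; binary16 and bfloat16 are deep but no named register is `≤ P` binades finer.
[this packet] -/
theorem drMulUnderflow_named_iff : ∀ X ∈ namedFormats, ∀ Y ∈ namedFormats,
    drMulUnderflowTest X Y = true ↔
    (X, Y) ∈ [(E4M3, Binary8p4), (E4M3, Binary8p4F), (E5M2, Binary8p3), (E5M2, Binary8p3F)] := by
  decide +kernel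

/-- THE `4` CELLS FAIL BY THE LAW: e5m2 → binary8p3 / binary8p3f at
`7·2^-16 · 5/64 = 35·2^-22 ↦ 2^-17 ↦ 0`, directly `2^-16`; e4m3 → binary8p4 / binary8p4f at
`15·2^-9 · 9/256 = 135·2^-17 ↦ 2^-10 ↦ 0`, directly `2^-9`; only e5m2 → binary8p3f is an embedded
pair (its failure was recorded by exhaustive search in `DOUBLE-ROUNDING-MUL.md`; here it is an
instance of a law). [this packet] -/
theorem drMulUnderflow_cells : ∀ p ∈ [(E4M3, Binary8p4), (E4M3, Binary8p4F), (E5M2, Binary8p3),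
    (E5M2, Binary8p3F)],
    ¬ DRMul p.1 p.2 ∧ (embedsTest p.1 p.2 = true ↔ p = (E5M2, Binary8p3F)) := by
  intro p hp
  simp only [List.mem_cons, List.not_mem_nil, or_false] at hp
  rcases hp with rfl | rfl | rfl | rfl
  all_goals exact ⟨not_drMul_of_underflowTest (by decide +kernel), by decide +kernel⟩

end Summit.Ventures.CertifiedArithmetic
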